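import Literature.MathematicalPhysics.QuantumFieldTheory.Balaban1983to89.B8Eq191FlatLettersDirichletRec
import Literature.MathematicalPhysics.QuantumFieldTheory.Balaban1983to89.B8Eq191FlatLettersExplicit

/-!
# `Balaban1983to89.B8Eq191FlatLettersExplicitRec` — [Balaban1985BackgroundPropagators] Thms 3.1–3.2 ∕ [Balaban1985RegularSpaces] (1.91) AT `U₀ = 1` FOR THE RECORD's AVERAGING STRUCTURE
# ([Balaban1987RG1] (0.3)): the seven flat letters WITH THEIR KERNELS DISPLAYED (`G′(1) = T⁻¹ ⊗ id`, `C(1) = (QT⁻¹T⁻¹Qᵀ)⁻¹ ⊗ id`, `H′ = T⁻¹T⁻¹Qᵀ(QT⁻¹T⁻¹Qᵀ)⁻¹ ⊗ id`, `Q(p,z) = L^{−dj}[flmZ L j z = y]`)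
# — the record twin of `B8Eq191FlatLettersExplicit` (R6, δ sub-chain; LEAD PEN dag-n05-e)

statement-level skeleton of published theorems with citation tags; proofs where landed; nothing here is a claim about the Yang–Mills mass gap

CITATION HEADER (lean-in-tree rule).  Cell `pub-ymgap` (D-0062), «N05-REC» road (director-ym №254∕№255; LEAD PEN dag-n05-e g37; desk `R6-PLAN.md` §2 (d)).  [6] = [Balaban1985RegularSpaces]
(1.91) p. 91, (1.95)–(1.98) p. 92, (1.101) p. 93, p. 96, Prop. 6 p. 99; [4] = [Balaban1985BackgroundPropagators] Thm 3.1 p. 397, Thm 3.2 p. 398, (3.19) p. 393, (3.23)–(3.25) p. 394; [B6] = [Balaban1984PropagatorsII]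
p. 235; [I] = [Balaban1987RG1] (0.3) p. 252.  `--kind proof --supports stmt-QuantumFields-20541` (K0⁷; count-neutral; no definition).  TOKEN MAP as in `B8Eq191FlatLettersDirichletRec`; record inputs
`B8Eq191FlatTowerGramRec.{isUnit_flatMatrixZ, isUnit_towerGramZ}`, `B8Eq191FlatStencilsRec.{QprimeIterZ_flat_eq_sum_of_supp, flatDirichletOpZ_eq_sum_of_supp, QprimeIter_bgTZ_one}`,
`B8Eq191FlatGreenDirichletRec.{QTZ_flat_add, QTZ_flat_smul}`, `B8Eq191FlatLettersDirichletRec.tower_sum_eq_bm`, dag-n05-d's `QTZ_flat_apply`; class-0 `kernel_comp`, `XSpace` BY NAME; proof text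
otherwise byte-identical to the engine's.  WHY: a seat proving the bounds (1.92)∕(1.98)∕(1.101) of the record's letters socket at the flat datum must SEE the operators (the `∃`-form hides them).
WHAT IS PROVED (sorry-free).  ★★ `exists_flatLettersZ_dirichlet_explicit` — the region as a `Finset` `S` (`hS`), the tower index set `B` (`hB`), the kernel `K` (`hK`, centred labels), the matrices
`T` (`hT`) and `Q` (`hQ`) as DATA with defining equations; the conclusion of `exists_flatLettersZ_dirichlet` (twelve laws) PLUS the four explicit kernel identities for `g`, `c` (and its vanishing
off `B`) and `H′`.
HONEST SCOPE.  Finite linear algebra at the flat background; existence and algebra only; NOT here: (1.92), (1.98), (1.101); nothing of [4]∕[6]∕[B6]∕[I] asserted beyond it; `HThm4Rec`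
UNDISCHARGED; N05 ∕ N07 NOT discharged; counts unmoved; one finite 𝕋⁴ programme at fixed ε — nothing continuum ∕ ℝ⁴ ∕ OS ∕ mass gap ∕ Clay.  No `def`, no `instance`, no `notation`, no `sorry`.
-/

noncomputable section

namespace Literature.MathematicalPhysics.QuantumFieldTheory.Balaban1983to89.B8Eq191FlatLettersExplicitRec

open Finset
open scoped Matrix
open B7Prop1Explicit (e)
open B7Eq78Linearization (QprimeIter QprimeIter_add QprimeIter_smul)
open B7SectEFLinearisationRec (zdBlockingZ bgTZ)
open B8Eq119TwistedAxialRec (flmZ)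
open B8Eq138LandauZd (covLap)
open B8Eq138LandauZdRec (QTZ)
open B8Eq138LandauFlatOrthogonalRec (QTZ_flat_apply)
open B8Eq1117Concrete (XSpace)
open B8Eq191FlatStencilsRec (QprimeIterZ_flat_eq_sum_of_supp flatDirichletOpZ_eq_sum_of_supp QprimeIter_bgTZ_one)
open B8Eq191FlatTowerGramRec (isUnit_flatMatrixZ isUnit_towerGramZ)
open B8Eq191FlatGreenDirichlet (covLap_flat_add covLap_flat_smul)
open B8Eq191FlatGreenDirichletRec (QTZ_flat_add QTZ_flat_smul)
open B8Eq191FlatLettersDirichlet (kernel_comp)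
open B8Eq191FlatLettersDirichletRec (tower_sum_eq_bm)

variable {d : ℕ}

section Letters

variable {𝔸 : Type*} [CStarAlgebra 𝔸]

open Classical in
/-- ★★ (RECORD TWIN of `exists_flatLetters_dirichlet_explicit`: centred blocking `zdBlockingZ ∕ bgTZ ∕ QTZ`, labels `flmZ`, odd `L`.) **ALL SEVEN [4]-LETTERS AT `U₀ = 1` ON A FINITE DIRICHLET REGION FOR THE RECORD's AVERAGING — EXPLICIT FORM (the kernels of `G′(1)`, `C(1)`, `H′` displayed as real
matrices, so that the bounds (1.92) ∕ (1.98) ∕ (1.101) become statements about `T⁻¹`, `(QT⁻²Qᵀ)⁻¹`)** ([4] Thms 3.1–3.2 at `U = 1`,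
existence and algebra only; [B6] p. 235).  Data: `d ≥ 1`, `η ≠ 0`, `L ≥ 1`, weights `a_j ≥ 0`, a finite region `Ω₀`, a finite structure `{Λ_j}_{j ≤ m}`
whose tower blocks are pairwise disjoint on `Ω₀` and meet `Ω₀`.  Letters: `g = G′(1) = K⁻¹ ⊗ id`, `Δ = Δ^η_1𝟙_{Ω₀}`, `q = Q′(1)` (levels `≤ m`, on `Λ_j`),
`qs = Q′(1)ᵀ`, `Aw = a`, `c = C(1) = (Q′G′(1)²Q′ᵀ)⁻¹ ⊗ id` on the tower space, `H′ = G′(1)²Q′ᵀC(1)` on the `X`-space.  Laws (the binder shapes of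
`B8SockHFPRD.sockHFP_body_of_join_RD` at `U₀ := 1`): `g_rightΩ`, `c_range`, `hΔ`, `hqs`, `hq`, the weight reading, `hHsupp`, `hHequiv`, `hQH` («`Q′H′ = I`»),
`hGsupp`, reality of `G′` (data self-adjoint on `Ω₀`) and of `G′Q′ᵀCQ′G′` (whence the `R`-reality).  NOT here: (1.92), (1.98), (1.101).
[cite: Balaban1985RegularSpaces, (1.91) p.91, (1.95)–(1.98) p.92, (1.101) p.93, p.96 («Q′H′ = I»), Prop. 6 p.99; Balaban1985BackgroundPropagators, Thms 3.1–3.2 p.397, (3.19) p.393, (3.23)–(3.25) p.394; Balaban1984PropagatorsII, p.235] -/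
theorem exists_flatLettersZ_dirichlet_explicit (hd : 0 < d) {η : ℝ} (hη : η ≠ 0) {L : ℕ} (hLo : Odd L) (m : ℕ) (Λs : ℕ → Set (Fin d → ℤ))
    (a : ℕ → ℝ) (ha : ∀ j, 0 ≤ a j) (Ω₀ : Set (Fin d → ℤ)) (S : Finset (Fin d → ℤ)) (hS : ∀ w, w ∈ S ↔ w ∈ Ω₀)
    (hmeet : ∀ j, j ≤ m → ∀ y ∈ Λs j, ∃ z ∈ Ω₀, flmZ L j z = y)
    (hdisj : ∀ j, j ≤ m → ∀ j', j' ≤ m → ∀ y ∈ Λs j, ∀ y' ∈ Λs j', ∀ z ∈ Ω₀,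
      flmZ L j z = y → flmZ L j' z = y' → j = j' ∧ y = y')
    -- the explicit data: tower index set, kernel, Dirichlet matrix, averaging matrix (letters with defining equations)
    (B : Finset (ℕ × (Fin d → ℤ))) (hB : ∀ p, p ∈ B ↔ p.1 ≤ m ∧ p.2 ∈ Λs p.1)
    (K : (Fin d → ℤ) → (Fin d → ℤ) → ℝ)
    (hK : ∀ x z, K x z = ((η ^ 2)⁻¹ * ∑ μ : Fin d, ((2 : ℝ) * (if z = x then (1 : ℝ) else 0) - (if z = x + e μ then (1 : ℝ) else 0)
      - (if z = x - e μ then (1 : ℝ) else 0))) +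
      (∑ j ∈ Finset.range (m + 1), (if flmZ L j x ∈ Λs j ∧ flmZ L j z = flmZ L j x then
        a j * ((((L : ℝ) ^ d)⁻¹) ^ j) ^ 2 else 0)))
    (T : Matrix ↥S ↥S ℝ) (hT : T = Matrix.of fun x z : ↥S => K x.1 z.1)
    (Q : Matrix ↥B ↥S ℝ)
    (hQ : Q = Matrix.of fun (p : ↥B) (z : ↥S) =>
      if flmZ L p.1.1 z.1 = p.1.2 then (((L : ℝ) ^ d)⁻¹) ^ p.1.1 else 0) :
    ∃ (g Δ : ((Fin d → ℤ) → 𝔸) →ₗ[ℂ] ((Fin d → ℤ) → 𝔸)) (q : ((Fin d → ℤ) → 𝔸) →ₗ[ℂ] (ℕ → (Fin d → ℤ) → 𝔸))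
      (qs : (ℕ → (Fin d → ℤ) → 𝔸) →ₗ[ℂ] ((Fin d → ℤ) → 𝔸)) (Aw c : (ℕ → (Fin d → ℤ) → 𝔸) →ₗ[ℂ] (ℕ → (Fin d → ℤ) → 𝔸))
      (H' : XSpace d m 𝔸 →ₗ[ℂ] ((Fin d → ℤ) → 𝔸)),
      (∀ x, ∀ y ∈ Ω₀, (Δ (g x) + qs (Aw (q (g x)))) y = x y) ∧
      (∀ f, q (g (g (qs (c (q f))))) = q f) ∧
      (∀ f, ∀ x ∈ Ω₀, Δ f x = covLap η (1 : (Fin d → ℤ) → Fin d → 𝔸ˣ) (Ω₀.indicator f) x) ∧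
      (∀ μ, ∀ x ∈ Ω₀, qs μ x = QTZ L m Λs (1 : (Fin d → ℤ) → Fin d → 𝔸ˣ) μ x) ∧
      (∀ f j, j ≤ m → ∀ y ∈ Λs j, q f j y = QprimeIter (zdBlockingZ d L) (bgTZ L (1 : (Fin d → ℤ) → Fin d → 𝔸ˣ)) j f y) ∧
      (∀ μ j y, Aw μ j y = a j • μ j y) ∧
      (∀ (X : XSpace d m 𝔸) (x : Fin d → ℤ), x ∉ Ω₀ → H' X x = 0) ∧
      (∀ X Y : XSpace d m 𝔸, (∀ p, Y p = -star (X p)) → ∀ x, H' Y x = -star (H' X x)) ∧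
      (∀ (Y : XSpace d m 𝔸) (j : ℕ) (hj : j ≤ m) (y : Fin d → ℤ), y ∈ Λs j →
        QprimeIter (zdBlockingZ d L) (bgTZ L (1 : (Fin d → ℤ) → Fin d → 𝔸ˣ)) j (H' Y) y = Y (⟨j, Nat.lt_succ_of_le hj⟩, y)) ∧
      (∀ f x, x ∉ Ω₀ → g f x = 0) ∧
      (∀ f, (∀ x ∈ Ω₀, IsSelfAdjoint (f x)) → ∀ x, IsSelfAdjoint (g f x)) ∧
      (∀ f, (∀ x ∈ Ω₀, IsSelfAdjoint (f x)) → ∀ x, IsSelfAdjoint (g (qs (c (q (g f)))) x)) ∧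
      -- the explicit kernels: `G′(1) = T⁻¹ ⊗ id`, `C(1) = (QT⁻¹T⁻¹Qᵀ)⁻¹ ⊗ id`, `H′ = T⁻¹T⁻¹Qᵀ(QT⁻¹T⁻¹Qᵀ)⁻¹ ⊗ id`
      (∀ (f : (Fin d → ℤ) → 𝔸) (w : ↥S), g f w.1 = ∑ z : ↥S, (T⁻¹ w z) • f z.1) ∧
      (∀ (φ : ℕ → (Fin d → ℤ) → 𝔸) (p : ↥B), c φ p.1.1 p.1.2 = ∑ p' : ↥B, ((Q * T⁻¹ * T⁻¹ * Qᵀ)⁻¹ p p') • φ p'.1.1 p'.1.2) ∧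
      (∀ (φ : ℕ → (Fin d → ℤ) → 𝔸) (j : ℕ) (y : Fin d → ℤ), (j, y) ∉ B → c φ j y = 0) ∧
      (∀ (Y : XSpace d m 𝔸) (w : ↥S), H' Y w.1 =
        ∑ p' : ↥B, ((T⁻¹ * (T⁻¹ * Qᵀ) * (Q * T⁻¹ * T⁻¹ * Qᵀ)⁻¹) w p') •
          Y (⟨p'.1.1, Nat.lt_succ_of_le ((hB p'.1).mp p'.2).1⟩, p'.1.2)) := by
  -- the unit matrices
  have hTdef : T = Matrix.of fun x z : ↥S => K x.1 z.1 := hT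
  have hQdef : Q = Matrix.of fun (p : ↥B) (z : ↥S) =>
      if flmZ L p.1.1 z.1 = p.1.2 then (((L : ℝ) ^ d)⁻¹) ^ p.1.1 else 0 := hQ
  have hTunit : IsUnit T := by rw [hTdef]; exact isUnit_flatMatrixZ hd hη L m Λs a ha K hK S
  have hTdet : IsUnit T.det := (Matrix.isUnit_iff_isUnit_det T).mp hTunit
  have hTT : T * T⁻¹ = 1 := Matrix.mul_nonsing_inv T hTdet
  have hmeetB : ∀ p ∈ B, ∃ z ∈ S, flmZ L p.1 z = p.2 := by
    intro p hp
    obtain ⟨z, hz, hbz⟩ := hmeet p.1 ((hB p).mp hp).1 p.2 ((hB p).mp hp).2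
    exact ⟨z, (hS z).mpr hz, hbz⟩
  have hdisjB : ∀ p ∈ B, ∀ p' ∈ B, ∀ z ∈ S, flmZ L p.1 z = p.2 → flmZ L p'.1 z = p'.2 → p = p' := by
    intro p hp p' hp' z hz h1 h2
    obtain ⟨hj, hy⟩ := hdisj p.1 ((hB p).mp hp).1 p'.1 ((hB p').mp hp').1 p.2 ((hB p).mp hp).2 p'.2 ((hB p').mp hp').2
      z ((hS z).mp hz) h1 h2
    exact Prod.ext hj hy
  set M : Matrix ↥B ↥B ℝ := Q * T⁻¹ * T⁻¹ * Qᵀ with hMdef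
  have hMunit : IsUnit M := by
    rw [hMdef, hTdef, hQdef]
    exact isUnit_towerGramZ hd hη hLo.pos m Λs a ha K hK S B hmeetB hdisjB
  have hMdet : IsUnit M.det := (Matrix.isUnit_iff_isUnit_det M).mp hMunit
  have hMM : M * M⁻¹ = 1 := Matrix.mul_nonsing_inv M hMdet
  have hMassoc : Q * (T⁻¹ * (T⁻¹ * Qᵀ)) = M := by
    rw [hMdef, Matrix.mul_assoc, Matrix.mul_assoc]
  -- the letters
  let g : ((Fin d → ℤ) → 𝔸) →ₗ[ℂ] ((Fin d → ℤ) → 𝔸) :=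
    { toFun := fun f w => if hw : w ∈ S then ∑ z : ↥S, (T⁻¹ ⟨w, hw⟩ z) • f z.1 else 0
      map_add' := fun f₁ f₂ => by
        funext w
        simp only [Pi.add_apply]
        split_ifs with hw
        · rw [← Finset.sum_add_distrib]
          exact Finset.sum_congr rfl fun z _ => smul_add _ _ _
        · rw [add_zero]
      map_smul' := fun r f => by
        funext w
        simp only [Pi.smul_apply, RingHom.id_apply]
        split_ifs with hw
        · rw [Finset.smul_sum]
          exact Finset.sum_congr rfl fun z _ => (smul_comm r _ _).symm
        · rw [smul_zero] }
  let Δ : ((Fin d → ℤ) → 𝔸) →ₗ[ℂ] ((Fin d → ℤ) → 𝔸) :=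
    { toFun := fun f x => covLap η (1 : (Fin d → ℤ) → Fin d → 𝔸ˣ) (Ω₀.indicator f) x
      map_add' := fun f₁ f₂ => by
        funext x
        rw [Pi.add_apply, ← covLap_flat_add]
        congr 1
        funext w
        by_cases hw : w ∈ Ω₀
        · simp only [Set.indicator_of_mem hw, Pi.add_apply]
        · simp only [Set.indicator_of_notMem hw, Pi.add_apply, add_zero]
      map_smul' := fun r f => by
        funext x
        rw [Pi.smul_apply, RingHom.id_apply, ← covLap_flat_smul]
        congr 1
        funext w
        by_cases hw : w ∈ Ω₀
        · simp only [Set.indicator_of_mem hw, Pi.smul_apply]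
        · simp only [Set.indicator_of_notMem hw, Pi.smul_apply, smul_zero] }
  let q : ((Fin d → ℤ) → 𝔸) →ₗ[ℂ] (ℕ → (Fin d → ℤ) → 𝔸) :=
    { toFun := fun f j y => if j ≤ m then
        (Λs j).indicator (QprimeIter (zdBlockingZ d L) (bgTZ L (1 : (Fin d → ℤ) → Fin d → 𝔸ˣ)) j f) y else 0
      map_add' := fun f₁ f₂ => by
        funext j y
        simp only [Pi.add_apply]
        split_ifs with hj
        · have hadd : QprimeIter (zdBlockingZ d L) (bgTZ L (1 : (Fin d → ℤ) → Fin d → 𝔸ˣ)) j (f₁ + f₂) =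
              fun y => QprimeIter (zdBlockingZ d L) (bgTZ L (1 : (Fin d → ℤ) → Fin d → 𝔸ˣ)) j f₁ y +
                QprimeIter (zdBlockingZ d L) (bgTZ L (1 : (Fin d → ℤ) → Fin d → 𝔸ˣ)) j f₂ y :=
            QprimeIter_add (zdBlockingZ d L) (bgTZ L 1) f₁ f₂ j
          by_cases hy : y ∈ Λs j
          · simp only [Set.indicator_of_mem hy, hadd]
          · simp only [Set.indicator_of_notMem hy, add_zero]
        · rw [add_zero]
      map_smul' := fun r f => by
        funext j y
        simp only [Pi.smul_apply, RingHom.id_apply]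
        split_ifs with hj
        · have hsm : QprimeIter (zdBlockingZ d L) (bgTZ L (1 : (Fin d → ℤ) → Fin d → 𝔸ˣ)) j (r • f) =
              fun y => r • QprimeIter (zdBlockingZ d L) (bgTZ L (1 : (Fin d → ℤ) → Fin d → 𝔸ˣ)) j f y :=
            QprimeIter_smul (zdBlockingZ d L) (bgTZ L 1) r f j
          by_cases hy : y ∈ Λs j
          · simp only [Set.indicator_of_mem hy, hsm]
          · simp only [Set.indicator_of_notMem hy, smul_zero]
        · rw [smul_zero] }
  let qs : (ℕ → (Fin d → ℤ) → 𝔸) →ₗ[ℂ] ((Fin d → ℤ) → 𝔸) :=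
    { toFun := fun μ x => QTZ L m Λs (1 : (Fin d → ℤ) → Fin d → 𝔸ˣ) μ x
      map_add' := fun μ ν => by funext x; exact QTZ_flat_add hLo m Λs μ ν x
      map_smul' := fun r μ => by funext x; exact QTZ_flat_smul hLo m Λs r μ x }
  let Aw : (ℕ → (Fin d → ℤ) → 𝔸) →ₗ[ℂ] (ℕ → (Fin d → ℤ) → 𝔸) :=
    { toFun := fun μ j y => a j • μ j y
      map_add' := fun μ ν => by funext j y; simp only [Pi.add_apply, smul_add]
      map_smul' := fun r μ => by funext j y; simp only [Pi.smul_apply, RingHom.id_apply]; rw [smul_comm] }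
  let c : (ℕ → (Fin d → ℤ) → 𝔸) →ₗ[ℂ] (ℕ → (Fin d → ℤ) → 𝔸) :=
    { toFun := fun φ j y => if h : (j, y) ∈ B then ∑ p : ↥B, (M⁻¹ ⟨(j, y), h⟩ p) • φ p.1.1 p.1.2 else 0
      map_add' := fun φ ψ => by
        funext j y
        simp only [Pi.add_apply]
        split_ifs with h
        · rw [← Finset.sum_add_distrib]
          exact Finset.sum_congr rfl fun p _ => smul_add _ _ _
        · rw [add_zero]
      map_smul' := fun r φ => by
        funext j y
        simp only [Pi.smul_apply, RingHom.id_apply]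
        split_ifs with h
        · rw [Finset.smul_sum]
          exact Finset.sum_congr rfl fun p _ => (smul_comm r _ _).symm
        · rw [smul_zero] }
  let Yt : XSpace d m 𝔸 →ₗ[ℂ] (ℕ → (Fin d → ℤ) → 𝔸) :=
    { toFun := fun Y j y => if h : j ≤ m then Y (⟨j, Nat.lt_succ_of_le h⟩, y) else 0
      map_add' := fun X Y => by
        funext j y
        simp only [Pi.add_apply, BoundedContinuousFunction.coe_add]
        split_ifs with h
        · rfl
        · rw [add_zero]
      map_smul' := fun r X => by
        funext j y
        simp only [Pi.smul_apply, RingHom.id_apply, BoundedContinuousFunction.coe_smul]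
        split_ifs with h
        · rfl
        · rw [smul_zero] }
  let H' : XSpace d m 𝔸 →ₗ[ℂ] ((Fin d → ℤ) → 𝔸) := g ∘ₗ g ∘ₗ qs ∘ₗ c ∘ₗ Yt
  -- kernel facts
  have hg_apply : ∀ (f : (Fin d → ℤ) → 𝔸) (w : Fin d → ℤ),
      g f w = if hw : w ∈ S then ∑ z : ↥S, (T⁻¹ ⟨w, hw⟩ z) • f z.1 else 0 := fun f w => rfl
  have hg_supp : ∀ (f : (Fin d → ℤ) → 𝔸) (w : Fin d → ℤ), w ∉ S → g f w = 0 := fun f w hw => by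
    rw [hg_apply, dif_neg hw]
  have hg_mem : ∀ (f : (Fin d → ℤ) → 𝔸) (z : ↥S), g f z.1 = ∑ w : ↥S, (T⁻¹ z w) • f w.1 := fun f z => by
    rw [hg_apply, dif_pos z.2]
  have hc_apply : ∀ (φ : ℕ → (Fin d → ℤ) → 𝔸) (p : ↥B), c φ p.1.1 p.1.2 = ∑ p' : ↥B, (M⁻¹ p p') • φ p'.1.1 p'.1.2 := by
    intro φ p
    show (if h : (p.1.1, p.1.2) ∈ B then ∑ p' : ↥B, (M⁻¹ ⟨(p.1.1, p.1.2), h⟩ p') • φ p'.1.1 p'.1.2 else 0) = _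
    rw [dif_pos p.2]
  have hqs_ker : ∀ (φ : ℕ → (Fin d → ℤ) → 𝔸) (z : ↥S), qs φ z.1 = ∑ p : ↥B, (Qᵀ z p) • φ p.1.1 p.1.2 := by
    intro φ z
    show QTZ L m Λs (1 : (Fin d → ℤ) → Fin d → 𝔸ˣ) φ z.1 = _
    rw [QTZ_flat_apply hLo, tower_sum_eq_bm L m Λs (flmZ L) B hB φ z.1, ← Finset.sum_coe_sort B]
    exact Finset.sum_congr rfl fun p _ => by rw [Matrix.transpose_apply, hQdef, Matrix.of_apply]
  have hgqs : ∀ (φ : ℕ → (Fin d → ℤ) → 𝔸) (z : ↥S), g (qs φ) z.1 = ∑ p : ↥B, ((T⁻¹ * Qᵀ) z p) • φ p.1.1 p.1.2 := by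
    intro φ z
    rw [hg_mem, Finset.sum_congr rfl fun w _ => by rw [hqs_ker φ w]]
    exact kernel_comp T⁻¹ Qᵀ (fun p : ↥B => φ p.1.1 p.1.2) z
  have hggqs : ∀ (φ : ℕ → (Fin d → ℤ) → 𝔸) (z : ↥S),
      g (g (qs φ)) z.1 = ∑ p : ↥B, ((T⁻¹ * (T⁻¹ * Qᵀ)) z p) • φ p.1.1 p.1.2 := by
    intro φ z
    rw [hg_mem, Finset.sum_congr rfl fun w _ => by rw [hgqs φ w]]
    exact kernel_comp T⁻¹ (T⁻¹ * Qᵀ) (fun p : ↥B => φ p.1.1 p.1.2) z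
  have hq_mem : ∀ (u : (Fin d → ℤ) → 𝔸), (∀ w, w ∉ S → u w = 0) → ∀ p : ↥B,
      q u p.1.1 p.1.2 = ∑ z : ↥S, (Q p z) • u z.1 := by
    intro u hu p
    have hp := (hB p.1).mp p.2
    show (if p.1.1 ≤ m then (Λs p.1.1).indicator
      (QprimeIter (zdBlockingZ d L) (bgTZ L (1 : (Fin d → ℤ) → Fin d → 𝔸ˣ)) p.1.1 u) p.1.2 else 0) = _
    rw [if_pos hp.1, Set.indicator_of_mem hp.2, QprimeIter_bgTZ_one, QprimeIterZ_flat_eq_sum_of_supp L hLo S u hu p.1.1 p.1.2, ← Finset.sum_coe_sort S]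
    exact Finset.sum_congr rfl fun z _ => by rw [hQdef, Matrix.of_apply]
  have hqggqs : ∀ (φ : ℕ → (Fin d → ℤ) → 𝔸) (p : ↥B),
      q (g (g (qs φ))) p.1.1 p.1.2 = ∑ p' : ↥B, (M p p') • φ p'.1.1 p'.1.2 := by
    intro φ p
    rw [hq_mem _ (hg_supp _) p, Finset.sum_congr rfl fun z _ => by rw [hggqs φ z],
      kernel_comp Q (T⁻¹ * (T⁻¹ * Qᵀ)) (fun p' : ↥B => φ p'.1.1 p'.1.2) p, hMassoc]
  have hqggqsc : ∀ (ψ : ℕ → (Fin d → ℤ) → 𝔸) (p : ↥B), q (g (g (qs (c ψ)))) p.1.1 p.1.2 = ψ p.1.1 p.1.2 := by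
    intro ψ p
    rw [hqggqs, Finset.sum_congr rfl fun p' _ => by rw [hc_apply ψ p'],
      kernel_comp M M⁻¹ (fun p' : ↥B => ψ p'.1.1 p'.1.2) p, hMM]
    simp only [Matrix.one_apply, ite_smul, one_smul, zero_smul]
    rw [Finset.sum_ite_eq]
    simp
  have hq_off : ∀ (u : (Fin d → ℤ) → 𝔸) (j : ℕ) (y : Fin d → ℤ), (j, y) ∉ B → q u j y = 0 := by
    intro u j y hjy
    show (if j ≤ m then (Λs j).indicator
      (QprimeIter (zdBlockingZ d L) (bgTZ L (1 : (Fin d → ℤ) → Fin d → 𝔸ˣ)) j u) y else 0) = 0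
    by_cases hj : j ≤ m
    · rw [if_pos hj, Set.indicator_of_notMem (fun hy => hjy ((hB (j, y)).mpr ⟨hj, hy⟩))]
    · rw [if_neg hj]
  have hH_ker : ∀ (Y : XSpace d m 𝔸) (z : ↥S),
      H' Y z.1 = ∑ p' : ↥B, (((T⁻¹ * (T⁻¹ * Qᵀ)) * M⁻¹) z p') • Yt Y p'.1.1 p'.1.2 := by
    intro Y z
    show g (g (qs (c (Yt Y)))) z.1 = _
    rw [hggqs, Finset.sum_congr rfl fun p' _ => by rw [hc_apply (Yt Y) p']]
    exact kernel_comp (T⁻¹ * (T⁻¹ * Qᵀ)) M⁻¹ (fun p' : ↥B => Yt Y p'.1.1 p'.1.2) z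
  have hYt : ∀ (Y : XSpace d m 𝔸) (p : ↥B), Yt Y p.1.1 p.1.2 = Y (⟨p.1.1, Nat.lt_succ_of_le ((hB p.1).mp p.2).1⟩, p.1.2) := by
    intro Y p
    show (if h : p.1.1 ≤ m then Y (⟨p.1.1, Nat.lt_succ_of_le h⟩, p.1.2) else 0) = _
    rw [dif_pos ((hB p.1).mp p.2).1]
  -- the flat operator of the letters is the kernel sum (as in `B8Eq191FlatGreenDirichlet`)
  have hop : ∀ (h : (Fin d → ℤ) → 𝔸), (∀ w, w ∉ S → h w = 0) → ∀ y, (Δ h + qs (Aw (q h))) y = ∑ z ∈ S, K y z • h z := by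
    intro h hsupp y
    have hind : Ω₀.indicator h = h := by
      funext w
      by_cases hw : w ∈ Ω₀
      · exact Set.indicator_of_mem hw h
      · rw [Set.indicator_of_notMem hw, hsupp w (fun hw' => hw ((hS w).mp hw'))]
    show covLap η (1 : (Fin d → ℤ) → Fin d → 𝔸ˣ) (Ω₀.indicator h) y + QTZ L m Λs (1 : (Fin d → ℤ) → Fin d → 𝔸ˣ)
        (fun j w => a j • (if j ≤ m then
          (Λs j).indicator (QprimeIter (zdBlockingZ d L) (bgTZ L (1 : (Fin d → ℤ) → Fin d → 𝔸ˣ)) j h) w else 0)) y =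
      ∑ z ∈ S, K y z • h z
    rw [hind]
    simp only [QprimeIter_bgTZ_one]
    rw [flatDirichletOpZ_eq_sum_of_supp L η hLo m Λs a S h hsupp y]
    exact Finset.sum_congr rfl fun z _ => by rw [hK]
  -- reality of the real-kernel letters
  have hg_real : ∀ (f : (Fin d → ℤ) → 𝔸), (∀ x ∈ Ω₀, IsSelfAdjoint (f x)) → ∀ x, IsSelfAdjoint (g f x) := by
    intro f hf x
    rw [hg_apply]
    split_ifs with hx
    · exact isSelfAdjoint_sum _ fun z _ => IsSelfAdjoint.smul (IsSelfAdjoint.all _) (hf z.1 ((hS z.1).mp z.2))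
    · exact IsSelfAdjoint.zero 𝔸
  refine ⟨g, Δ, q, qs, Aw, c, H', ?_, ?_, fun f x _ => rfl, fun μ x _ => rfl, ?_, fun μ j y => rfl, ?_, ?_, ?_, ?_, hg_real, ?_,
    hg_mem, hc_apply, ?_, fun Y w => by rw [hH_ker Y w]; exact Finset.sum_congr rfl fun p' _ => by rw [hYt Y p']⟩
  · -- `g_rightΩ`
    intro f y hy
    have hyS : y ∈ S := (hS y).mpr hy
    rw [hop (g f) (hg_supp f) y, ← Finset.sum_coe_sort S]
    have h1 : ∀ z : ↥S, K y z.1 • g f z.1 = ∑ w : ↥S, (T ⟨y, hyS⟩ z * T⁻¹ z w) • f w.1 := by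
      intro z
      rw [hg_mem f z, Finset.smul_sum]
      exact Finset.sum_congr rfl fun w _ => by rw [smul_smul, hTdef, Matrix.of_apply]
    rw [Finset.sum_congr rfl fun z _ => h1 z, Finset.sum_comm]
    have h2 : ∀ w : ↥S, ∑ z : ↥S, (T ⟨y, hyS⟩ z * T⁻¹ z w) • f w.1 = ((1 : Matrix ↥S ↥S ℝ) ⟨y, hyS⟩ w) • f w.1 := by
      intro w
      rw [← Finset.sum_smul, ← hTT, Matrix.mul_apply]
    rw [Finset.sum_congr rfl fun w _ => h2 w]
    simp only [Matrix.one_apply, ite_smul, one_smul, zero_smul]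
    rw [Finset.sum_ite_eq]
    simp
  · -- `c_range`
    intro f
    funext j y
    by_cases hjy : (j, y) ∈ B
    · exact hqggqsc (q f) ⟨(j, y), hjy⟩
    · rw [hq_off _ j y hjy, hq_off _ j y hjy]
  · -- `hq`
    intro f j hj y hy
    show (if j ≤ m then (Λs j).indicator (QprimeIter (zdBlockingZ d L) (bgTZ L (1 : (Fin d → ℤ) → Fin d → 𝔸ˣ)) j f) y
      else 0) = _
    rw [if_pos hj, Set.indicator_of_mem hy]
  · -- `hHsupp`
    intro X x hx
    show g (g (qs (c (Yt X)))) x = 0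
    exact hg_supp _ x (fun hxS => hx ((hS x).mp hxS))
  · -- `hHequiv`
    intro X Y hXY x
    by_cases hx : x ∈ S
    · rw [hH_ker Y ⟨x, hx⟩, hH_ker X ⟨x, hx⟩, star_sum, ← Finset.sum_neg_distrib]
      refine Finset.sum_congr rfl fun p _ => ?_
      rw [hYt Y p, hYt X p, hXY, smul_neg, star_smul]
      simp only [star_trivial]
    · have h1 : H' Y x = 0 := hg_supp _ x hx
      have h2 : H' X x = 0 := hg_supp _ x hx
      rw [h1, h2, star_zero, neg_zero]
  · -- `hQH` («Q′H′ = I» at the tower sites)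
    intro Y j hj y hy
    have hjy : (j, y) ∈ B := (hB (j, y)).mpr ⟨hj, hy⟩
    have hread : QprimeIter (zdBlockingZ d L) (bgTZ L (1 : (Fin d → ℤ) → Fin d → 𝔸ˣ)) j (H' Y) y = q (H' Y) j y := by
      show _ = (if j ≤ m then (Λs j).indicator
        (QprimeIter (zdBlockingZ d L) (bgTZ L (1 : (Fin d → ℤ) → Fin d → 𝔸ˣ)) j (H' Y)) y else 0)
      rw [if_pos hj, Set.indicator_of_mem hy]
    rw [hread]
    have h1 := hqggqsc (Yt Y) ⟨(j, y), hjy⟩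
    have h2 := hYt Y ⟨(j, y), hjy⟩
    exact h1.trans h2
  · -- `hGsupp`
    intro f x hx
    exact hg_supp f x (fun hxS => hx ((hS x).mp hxS))
  · -- reality of `G′Q′ᵀCQ′G′f`
    intro f hf x
    refine hg_real _ (fun w hw => ?_) x
    have hwS : w ∈ S := (hS w).mpr hw
    rw [show qs (c (q (g f))) w = qs (c (q (g f))) (⟨w, hwS⟩ : ↥S).1 from rfl, hqs_ker]
    refine isSelfAdjoint_sum _ fun p _ => IsSelfAdjoint.smul (IsSelfAdjoint.all _) ?_
    rw [hc_apply]
    refine isSelfAdjoint_sum _ fun p' _ => IsSelfAdjoint.smul (IsSelfAdjoint.all _) ?_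
    rw [hq_mem _ (hg_supp f) p']
    exact isSelfAdjoint_sum _ fun z _ => IsSelfAdjoint.smul (IsSelfAdjoint.all _) (hg_real f hf z.1)
  · -- `c` vanishes off the tower index set
    intro φ j y hjy
    show (if h : (j, y) ∈ B then ∑ p' : ↥B, (M⁻¹ ⟨(j, y), h⟩ p') • φ p'.1.1 p'.1.2 else 0) = 0
    rw [dif_neg hjy]


end Letters


end Literature.MathematicalPhysics.QuantumFieldTheory.Balaban1983to89.B8Eq191FlatLettersExplicitRec

end
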